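import Mathlib.Analysis.SpecialFunctions.Pow.Continuity
import Literature.Barriers.CriticalPhenomena.ScaleCovarianceNotMoebius
import HarnessLib

/-!
# Barrier: an isotropic two-point power law does not produce a Möbius-covariant scaling limit

Barrier catalogue `Literature/Barriers/CriticalPhenomena/` (D-0021), entry for the sub-problem
`CriticalPhenomena/Ising3DConformalLimit`; companion of `ScaleCovarianceNotMoebius.lean`, whose
sharpened witness `ScaleNotMoebius.narrowFamily Δ` it reads on the lattice `ℤ³`.

What the sources print. The conformal (Möbius) covariance of the critical 3D Ising correlators and
already the EXISTENCE of their scaling limits are open (Duminil-Copin, ICM 2022, §8.4, p. 29: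
"proving that the critical 3D Ising model indeed converges to a CFT [is] widely open … proving
that these scaling limits indeed exist"); the two-point function alone does not determine a field
theory (generalised free fields share their two-point function with interacting theories of the
same `Δ`; Poland–Rychkov–Vichi 2019, §I–II: the CFT data are `{Δᵢ, λᵢⱼₖ}`, not `Δ_σ` alone), and
scale covariance does not force conformal covariance for bare correlation families
(`ScaleCovarianceNotMoebiusNarrow`, with the printed examples recalled there).

What is proved here (no `sorry`, no new axiom). Write `G♮_Δ` for the lattice family
`n, k ↦ narrowFamily Δ n (k : (ℝ³)ⁿ)` (the barrier witness sampled on integer points).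
* `ScaleNotMoebius.latticeSample_narrowFamily_twoPointLaw` — `G♮_Δ` has the EXACT isotropic
  two-point power law `G₂(0,x) ‖x‖₂^{2Δ} = 1`, `x ≠ 0`.
* `ScaleNotMoebius.latticeSample_narrowFamily_tendsto` — renormalised by `δ^{-Δ}`, `G♮_Δ`
  converges pointwise on non-coincident configurations to `narrowFamily Δ` (scale covariance +
  continuity; rounding moves points by `≤ δ` per coordinate).
* `ScaleNotMoebius.tendsto_rescaledCorrelator_unique_upToScalar` — two non-degenerate pointwise
  scaling limits `(ρ, S)`, `(ρ', S')` of ONE lattice family satisfy `S' n = κⁿ S n` on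
  non-coincident configurations (`κ > 0`): renormalisation freedom is a single scalar.
* `not_exists_moebiusLimit_latticeSample` — hence `G♮_Δ` (`Δ > 0`) has NO non-degenerate
  Möbius-covariant pointwise scaling limit under ANY renormalisation `ρ` and ANY dimension `Δ'`
  (the candidate is `κⁿ narrowFamily Δ`, its dimension is forced to `Δ`, and inversion covariance
  at `(e, 2e, 3e, 4e)` would read `(24/65)^{2Δ} = (24/40)^{2Δ}`).
* `TwoPointLawMoebiusUpgradeFor G` — the TECHNIQUE CLASS as a predicate on lattice families `G`
  (two-point isotropic power law of `G` ⇒ a non-degenerate Möbius-covariant scaling limit of `G`;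
  the shape of route item `MoebiusLimitOfTwoPointLaw` of `Theses/PrecisionLaplacian.lean` /
  `Theses/BernsteinTemperature.lean`, which is the instance `G := criticalCorr 3`);
  `not_twoPointLawMoebiusUpgradeFor_latticeSample` — it FAILS at `G♮_Δ` (`Δ > 0`); hence
  `not_twoPointLawMoebiusUpgrade : ¬ ∀ G, TwoPointLawMoebiusUpgradeFor G` — the master statement of
  the class is FALSE (its former closed spelling, the `Prop`-valued declaration
  `TwoPointLawMoebiusUpgrade`, is retired and DELETED, see "Verdict clean-up" below).

## Verdict clean-up 2026-08-15/16 (RETIRE-REFUTED; prove-seat of `TwoPointLawMoebiusUpgrade`, three sessions; source re-read: printed pp. 197–198 and 203 = EMS Press PDF pp. 34–35, 40 = arXiv pp. 25, 29; re-read again 2026-08-16, arXiv p. 25 l. 26 and p. 29 l. 1)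

`TwoPointLawMoebiusUpgrade` was vendored as a CLOSED `def … : Prop` (the technique class written as
one proposition `∀ G, …`) so that it could be attacked, and the named-fact ledger then read it as
literature debt awaiting `TwoPointLawMoebiusUpgrade_holds`. No such discharge can exist: the
statement is FALSE by design — its negation is the in-tree theorem `not_twoPointLawMoebiusUpgrade`
(witness `G♮_1`). Nor is it a published result: the cited source DEFINES conformal covariance of a
putative scaling limit for the ISING family ("what do we mean by conformal invariance? … it would
for instance mean that there exists a way of renormalizing … such that they converge to quantities
… that satisfy …", §8.1, eqs. (8.1)–(8.4)) and records that "proving that the critical 3D Ising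
model indeed converges to a CFT [is] widely open … proving that these scaling limits indeed exist"
(§8.4); that Ising instance is the route item `MoebiusLimitOfTwoPointLaw` (an obligation under
`Summits/`, not Literature), while the model-blind generalisation to every lattice family is
refuted here. Treatment, as for the catalogue's other refuted technique classes
(`Literature.Barriers.AnomalousDissipation.ForceRobustNoAnomaly`,
`Literature.Barriers.RiemannHypothesis.PolyaConjecture`): the class is now the parametrised
predicate `TwoPointLawMoebiusUpgradeFor G`, with which every theorem of this file is written
(`not_twoPointLawMoebiusUpgrade` reads `¬ ∀ G, TwoPointLawMoebiusUpgradeFor G`, definitionally the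
statement it had). The closed def was first kept (p70906, 2026-08-15) as a `@[deprecated]` tombstone,
because the standing disproof work file
`Summits/CriticalPhenomena/Ising3DConformalLimit/Cruxes/MoebiusLimitOfTwoPointLaw/Disproof.lean`
still named it; that file has since been rewired to the predicate
(`ModelBlindCrux := ∀ G, TwoPointLawMoebiusUpgradeFor G`, `not_modelBlindCrux := not_twoPointLawMoebiusUpgrade`),
no module names the closed def any more, and it is DELETED reference-free (2026-08-16): the name
`Literature.Barriers.CriticalPhenomena.TwoPointLawMoebiusUpgrade` no longer exists; its statement is
spelled `∀ G, TwoPointLawMoebiusUpgradeFor G` and its refutation of record is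
`not_twoPointLawMoebiusUpgrade` (witness: `not_twoPointLawMoebiusUpgradeFor_latticeSample`). No
corrected restatement is vendored: the corrected form of a refuted technique class is its negation,
which IS the barrier theorem. The barrier itself (`not_exists_moebiusLimit_latticeSample`) is
unchanged.

- technique_class: two-point-spine, two-point-law-first, model-blind-scaling-limit
- blocks: deriving clauses (i)–(ii) of `CritIsing3DConformalLimit` (existence of the `n`-point scaling limits, their non-degeneracy and Möbius covariance) from the isotropic pure power law of the critical two-point function by an argument that does not use further properties of `criticalCorr 3` — in particular closing route item `MoebiusLimitOfTwoPointLaw` (stmt-CriticalPhenomena-4801) "by the two-point law"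
- because: the sampled barrier witness has the exact two-point law and no Möbius-covariant non-degenerate scaling limit whatsoever (`not_exists_moebiusLimit_latticeSample`, `not_twoPointLawMoebiusUpgradeFor_latticeSample`, `not_twoPointLawMoebiusUpgrade`, proved below); already EXISTENCE of the four-point limit is not implied by the two-point law (take `G₄ ≡ 1`: `ρ(δ)²δ^{2Δ} → s > 0` forces `ρ⁴ G₄ → ∞`) [folklore]; in print: existence and conformal covariance of the 3D limits are open [cite: DuminilCopinICM2022, §8.4 p. 29], the two-point function does not fix the theory [cite: PolandRychkovVichi2019, §I p. 3]
- evasions_known: inputs OUTSIDE the class — properties of `criticalCorr 3` beyond its two-point function: reflection positivity of the full family on tori / OS positivity of the limit TOGETHER WITH the exponent window `Δ ≤ 1` that the two-point law of `criticalCorr 3` forces (`twoPointLaw_exponent_mem_Icc`) — reflection positivity ALONE is not an evasion: for every weight `h ≥ 3` there are OS-positive, Euclidean-invariant, scale-covariant Schwinger families with EXACT pure-power `S₂` whose `S₄` is not inversion covariant, namely the correlators of the scalar descendants `s = Δ:φ²:` of the (generalized) free fields (`⟨φφ⟩ = |x|^{-2Δ_φ}`, `Δ_φ ≥ 1/2`,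 `h = 2Δ_φ + 2`; at `Δ_φ = 1/2` the field is Nelson's Markov free field and `s = 2:|∇φ|²:`): the `2+2` Wick class of `S₄` is covariant, the `4`-cycle class is not [computed: crux stmt-CriticalPhenomena-4801 evidence `WITNESS.md` / `Cruxes/MoebiusLimitOfTwoPointLaw/RPDescendantWitness.md`, exact rational and 110-digit finite differences at weights 4 and 3, inversion ratio 1.148/1.138 resp. 0.807/6.35 against 1.000000 for the control class; kit j007583] [cite: DiFrancescoMathieuSenechal1997, §4.2 (descendants are not quasi-primary)]; such witnesses need `h ≥ 5/2` (no scalar non-primary below `5/2` in a unitary 3D CFT), which the Ising window excludes; further evasions: the DLR–Markov–FKG structure of the Gibbs state FOR THE OBSERVED FIELD (a local functional of a Markov field is not enough, same witness at `h = 3`), random-current representations and lattice Ward identities [cite: DuminilCopinICM2022, §8.2 p. 26 (the planar mechanism)]; the physics-level upgrade "no integrated vector operator of dimension `2`" [cite: DelamotteTissierWschebor2016, §6 p. 10] with the Monte Carlo bound `Δ_V > 5.0` [cite: MenesesEtAl2019, §1]; `d = 2`: Chelkak–Hongler–Izyurov [cite: ChelkakHonglerIzyurov2015, Thm 1.2]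
- scope_caveats: (a) the witness is a two-and-four-point object (`Sₙ = 0`, `n ≥ 5`), not the moment family of a random field and not reflection positive (reflection-positive witnesses exist, but only with weight `h ≥ 3`, outside the Ising window — see `evasions_known`); (b) it says nothing against the IMPLICATION `MoebiusLimitOfTwoPointLaw` for `criticalCorr 3` itself, which is weaker than the summit conjunct and is expected to be true — it only locates where a proof must look; (c) typed on `ℝ³`/`ℤ³`, the construction is dimension-free; (d) the renormalisation in `latticeSample_narrowFamily_tendsto` is the pure power `δ^{-Δ}`; by `tendsto_rescaledCorrelator_unique_upToScalar` any other admissible renormalisation differs by an asymptotic scalar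
- status: established (theorems `not_exists_moebiusLimit_latticeSample`, `not_twoPointLawMoebiusUpgradeFor_latticeSample`, `not_twoPointLawMoebiusUpgrade` below; the closed technique-class def `TwoPointLawMoebiusUpgrade` is REFUTED by `not_twoPointLawMoebiusUpgrade` and deleted, verdict clean-up 2026-08-15/16)
-/

noncomputable section

namespace Literature.Barriers.CriticalPhenomena

open Literature.Probability.LatticeModels EuclideanGeometry

/-- **Technique class (predicate form): the two-point-law Möbius upgrade FOR ONE lattice family.**
`TwoPointLawMoebiusUpgradeFor G`: if the two-point function of the lattice family `G` on `ℤ³` has an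
isotropic pure power law, `G₂(0,x) ‖x‖₂^{2Δ} → c > 0` cofinitely, then `G` has a non-degenerate
Möbius-covariant pointwise scaling limit for some renormalisation `ρ > 0` on `(0,1]` and some
dimension `Δ' > 0`. This is the shape of route item
`Summit.CriticalPhenomena.Ising3DConformalLimit.Theses.PrecisionLaplacian.MoebiusLimitOfTwoPointLaw`,
which is its instance `G := criticalCorr 3`; the conclusion is conformal (Möbius) covariance of the
scaling limit in the sense of Duminil-Copin, ICM 2022, §8.1, eqs. (8.1) and (8.3), posed there for the
Ising family only and open in `d = 3` (§8.4). A DEFINITION — the class of statements the barrier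
quantifies over — not a claim: the class member `G♮_Δ` violates it
(`not_twoPointLawMoebiusUpgradeFor_latticeSample`), so `∀ G, TwoPointLawMoebiusUpgradeFor G` is false
(`not_twoPointLawMoebiusUpgrade`). [cite: DuminilCopinICM2022, §8.1 p. 25 and §8.4 p. 29] -/
def TwoPointLawMoebiusUpgradeFor (G : LatticeCorrFamily 3) : Prop :=
  (∃ Δ c : ℝ, 0 < c ∧ Filter.Tendsto (fun x : Site 3 =>
      G 2 ![0, x] * Real.sqrt (∑ i, ((x i : ℝ)) ^ 2) ^ (2 * Δ)) Filter.cofinite (nhds c)) →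
    ∃ (ρ : ℝ → ℝ) (Δ : ℝ) (S : CorrFamily 3), (∀ δ ∈ Set.Ioc (0:ℝ) 1, 0 < ρ δ) ∧ 0 < Δ ∧
      HasPointwiseScalingLimit G ρ S ∧ IsNondegenerateTwoPoint S ∧ IsMoebiusCovariant Δ S

namespace ScaleNotMoebius

open Filter Topology

/-! #### Reference pairs on the first axis -/

/-- The reference pair `(0, e)` is non-coincident. [folklore] -/
theorem zero_axisUnit_mem_nonCoincident :
    (![0, axisUnit] : Fin 2 → EuclideanSpace ℝ (Fin 3)) ∈ NonCoincident 3 2 := by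
  rw [mem_nonCoincident, injective_fin_two_iff]
  simpa using axisUnit_ne_zero.symm

/-- The pair `(0, 2e)` is non-coincident. [folklore] -/
theorem zero_two_smul_axisUnit_mem_nonCoincident :
    (![0, (2 : ℝ) • axisUnit] : Fin 2 → EuclideanSpace ℝ (Fin 3)) ∈ NonCoincident 3 2 := by
  rw [mem_nonCoincident, injective_fin_two_iff]
  simpa using (smul_ne_zero two_ne_zero axisUnit_ne_zero).symm

/-! #### Uniqueness of pointwise scaling limits up to a scalar -/

/-- **Pointwise scaling limits of one lattice family are unique up to a scalar.** If the
rescaled correlators of `G` converge pointwise on non-coincident configurations both with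
`(ρ, S)` and with `(ρ', S')`, `ρ, ρ' > 0` on `(0,1]`, and both two-point limits are
non-degenerate, then `S' n = κⁿ S n` on non-coincident configurations for one constant `κ > 0`
(`κ² = S'₂(0,e)/S₂(0,e)` and `ρ'/ρ → κ`). [folklore] -/
theorem tendsto_rescaledCorrelator_unique_upToScalar {G : LatticeCorrFamily 3} {ρ ρ' : ℝ → ℝ}
    {S S' : CorrFamily 3} (hρ : ∀ δ ∈ Set.Ioc (0 : ℝ) 1, 0 < ρ δ)
    (hρ' : ∀ δ ∈ Set.Ioc (0 : ℝ) 1, 0 < ρ' δ)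
    (h : ∀ n, ∀ x ∈ NonCoincident 3 n,
      Tendsto (fun δ => rescaledCorrelator G ρ n δ x) (𝓝[>] 0) (𝓝 (S n x)))
    (h' : ∀ n, ∀ x ∈ NonCoincident 3 n,
      Tendsto (fun δ => rescaledCorrelator G ρ' n δ x) (𝓝[>] 0) (𝓝 (S' n x)))
    (hnd : IsNondegenerateTwoPoint S) (hnd' : IsNondegenerateTwoPoint S') :
    ∃ κ : ℝ, 0 < κ ∧ ∀ n, ∀ x ∈ NonCoincident 3 n, S' n x = κ ^ n * S n x := by
  set x₂ : Fin 2 → EuclideanSpace ℝ (Fin 3) := ![0, axisUnit] with hx₂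
  have hx₂mem : x₂ ∈ NonCoincident 3 2 := zero_axisUnit_mem_nonCoincident
  set s := S 2 x₂ with hs
  set s' := S' 2 x₂ with hs'
  have hspos : 0 < s := hnd _ hx₂mem
  have hs'pos : 0 < s' := hnd' _ hx₂mem
  have ha := h 2 x₂ hx₂mem
  have ha' := h' 2 x₂ hx₂mem
  set q : ℝ → ℝ := fun δ => ρ' δ / ρ δ with hq
  have hIoc : ∀ᶠ δ : ℝ in 𝓝[>] 0, δ ∈ Set.Ioc (0 : ℝ) 1 := Ioc_mem_nhdsGT one_pos
  have hGne : ∀ᶠ δ : ℝ in 𝓝[>] 0, rescaledCorrelator G ρ 2 δ x₂ ≠ 0 := ha.eventually_ne hspos.ne'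
  have hq2 : Tendsto (fun δ => q δ ^ 2) (𝓝[>] 0) (𝓝 (s' / s)) := by
    refine (ha'.div ha hspos.ne').congr' ?_
    filter_upwards [hIoc, hGne] with δ hδ hne
    simp only [rescaledCorrelator_apply, Pi.div_apply] at hne ⊢
    have hρne : ρ δ ≠ 0 := (hρ δ hδ).ne'
    have hG2 : G 2 (fun i => latticeApprox δ (x₂ i)) ≠ 0 := fun h0 => hne (by rw [h0, mul_zero])
    rw [hq]
    field_simp
  set κ := Real.sqrt (s' / s) with hκ
  have hκpos : 0 < κ := Real.sqrt_pos.2 (div_pos hs'pos hspos)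
  have hqlim : Tendsto q (𝓝[>] 0) (𝓝 κ) := by
    refine hq2.sqrt.congr' ?_
    filter_upwards [hIoc] with δ hδ
    exact Real.sqrt_sq (div_pos (hρ' δ hδ) (hρ δ hδ)).le
  refine ⟨κ, hκpos, fun n x hx => ?_⟩
  have hprod : Tendsto (fun δ => q δ ^ n * rescaledCorrelator G ρ n δ x) (𝓝[>] 0)
      (𝓝 (κ ^ n * S n x)) := (hqlim.pow n).mul (h n x hx)
  have heq : (fun δ => q δ ^ n * rescaledCorrelator G ρ n δ x) =ᶠ[𝓝[>] 0]
      fun δ => rescaledCorrelator G ρ' n δ x := by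
    filter_upwards [hIoc] with δ hδ
    simp only [rescaledCorrelator_apply, hq]
    rw [div_pow, ← mul_assoc, div_mul_cancel₀ _ (pow_ne_zero n (hρ δ hδ).ne')]
  exact tendsto_nhds_unique (h' n x hx) (hprod.congr' heq)

/-! #### The witness sampled on `ℤ³`: two-point law and pointwise convergence -/

/-- The Euclidean norm of an integer point of `ℝ³`. [folklore] -/
theorem norm_toLp_intCast (x : Site 3) :
    ‖(WithLp.toLp 2 fun j => ((x j : ℤ) : ℝ) : EuclideanSpace ℝ (Fin 3))‖ =
      Real.sqrt (∑ i, ((x i : ℝ)) ^ 2) := by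
  rw [EuclideanSpace.norm_eq]
  congr 1
  refine Finset.sum_congr rfl fun i _ => ?_
  rw [PiLp.toLp_apply, Real.norm_eq_abs, sq_abs]

/-- `√(∑ xᵢ²) > 0` for `x ≠ 0` in `ℤ³`. [folklore] -/
theorem sqrt_sum_sq_pos {x : Site 3} (hx : x ≠ 0) : 0 < Real.sqrt (∑ i, ((x i : ℝ)) ^ 2) := by
  rw [Real.sqrt_pos]
  obtain ⟨i, hi⟩ : ∃ i, x i ≠ 0 := by
    by_contra hall
    push Not at hall
    exact hx (funext hall)
  have hpos : (0 : ℝ) < ((x i : ℝ)) ^ 2 := by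
    have : (x i : ℝ) ≠ 0 := by exact_mod_cast hi
    positivity
  exact lt_of_lt_of_le hpos (Finset.single_le_sum (f := fun j => ((x j : ℝ)) ^ 2)
    (fun _ _ => sq_nonneg _) (Finset.mem_univ i))

/-- **Exact isotropic two-point law of the sampled witness**: `G₂(0,x) · ‖x‖₂^{2Δ} = 1` for
`x ≠ 0`, so the cofinite limit exists and is positive. [folklore] -/
theorem latticeSample_narrowFamily_twoPointLaw (Δ : ℝ) :
    ∃ Δ' c : ℝ, 0 < c ∧ Tendsto (fun x : Site 3 =>
      narrowFamily Δ 2 (fun i => (WithLp.toLp 2 fun j =>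
          (((![0, x] : Fin 2 → Site 3) i j : ℤ) : ℝ) : EuclideanSpace ℝ (Fin 3))) *
        Real.sqrt (∑ i, ((x i : ℝ)) ^ 2) ^ (2 * Δ')) cofinite (nhds c) := by
  refine ⟨Δ, 1, one_pos, ?_⟩
  refine (tendsto_const_nhds (x := (1 : ℝ))).congr' ?_
  filter_upwards [eventually_cofinite_ne (0 : Site 3)] with x hx
  have hlen := sqrt_sum_sq_pos hx
  rw [narrowFamily_two, twoPt]
  simp only [Matrix.cons_val_zero, Matrix.cons_val_one, Pi.zero_apply, Int.cast_zero]
  have h0 : (WithLp.toLp 2 fun _ : Fin 3 => (0 : ℝ) : EuclideanSpace ℝ (Fin 3)) = 0 := by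
    ext j; simp
  rw [h0, zero_sub, norm_neg, norm_toLp_intCast, Real.rpow_neg hlen.le,
    inv_mul_cancel₀ (Real.rpow_pos_of_pos hlen _).ne']

/-- `δ ⌊t/δ⌋ → t` as `δ → 0⁺`. [folklore] -/
theorem tendsto_mesh_mul_floor (t : ℝ) :
    Tendsto (fun δ : ℝ => δ * (⌊t / δ⌋ : ℝ)) (𝓝[>] 0) (𝓝 t) := by
  have hlow : Tendsto (fun δ : ℝ => t - δ) (𝓝[>] 0) (𝓝 t) := by
    have h : Tendsto (fun δ : ℝ => t - δ) (𝓝 0) (𝓝 (t - 0)) :=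
      (continuous_const.sub continuous_id).tendsto 0
    rw [sub_zero] at h
    exact tendsto_nhdsWithin_of_tendsto_nhds h
  have hpos : ∀ᶠ δ : ℝ in 𝓝[>] 0, 0 < δ := eventually_mem_nhdsWithin
  refine tendsto_of_tendsto_of_tendsto_of_le_of_le' hlow tendsto_const_nhds ?_ ?_
  · filter_upwards [hpos] with δ hδ
    have h1 := Int.sub_one_lt_floor (t / δ)
    have h2 : δ * (t / δ - 1) = t - δ := by field_simp
    nlinarith
  · filter_upwards [hpos] with δ hδ
    have h1 := Int.floor_le (t / δ)
    have h2 : δ * (t / δ) = t := by field_simp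
    nlinarith

/-- Rounded points converge: `δ • [p/δ] → p` in `ℝ³` as `δ → 0⁺`. [folklore] -/
theorem tendsto_mesh_smul_round (p : EuclideanSpace ℝ (Fin 3)) :
    Tendsto (fun δ : ℝ => δ • (WithLp.toLp 2 fun j => ((latticeApprox δ p j : ℤ) : ℝ) :
      EuclideanSpace ℝ (Fin 3))) (𝓝[>] 0) (𝓝 p) := by
  have hcoord : Tendsto (fun δ : ℝ => fun j : Fin 3 => δ * (⌊p j / δ⌋ : ℝ)) (𝓝[>] 0)
      (𝓝 fun j => p j) :=
    tendsto_pi_nhds.2 fun j => tendsto_mesh_mul_floor (p j)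
  have h := ((PiLp.continuous_toLp 2 (fun _ : Fin 3 => ℝ)).tendsto _).comp hcoord
  have hp : WithLp.toLp 2 (fun j => p j) = p := rfl
  rw [hp] at h
  refine h.congr fun δ => ?_
  ext j
  simp [latticeApprox_apply]

/-- Rounded configurations converge: `(δ • [xᵢ/δ])ᵢ → x`. [folklore] -/
theorem tendsto_mesh_smul_round_config {n : ℕ} (x : Fin n → EuclideanSpace ℝ (Fin 3)) :
    Tendsto (fun δ : ℝ => fun i => δ • (WithLp.toLp 2 fun j => ((latticeApprox δ (x i) j : ℤ) : ℝ) :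
      EuclideanSpace ℝ (Fin 3))) (𝓝[>] 0) (𝓝 x) :=
  tendsto_pi_nhds.2 fun i => tendsto_mesh_smul_round (x i)

/-- By scale covariance, the sampled witness renormalised by `δ^{-Δ}` at mesh `δ` is the witness
at the rounded configuration: `δ^{-nΔ} N n [x/δ] = N n (δ • [x/δ])`. [folklore] -/
theorem rescaledCorrelator_latticeSample_narrowFamily (Δ : ℝ) (n : ℕ) {δ : ℝ} (hδ : 0 < δ)
    (x : Fin n → EuclideanSpace ℝ (Fin 3)) :
    rescaledCorrelator (fun n k => narrowFamily Δ n (fun i =>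
        (WithLp.toLp 2 fun j => ((k i j : ℤ) : ℝ) : EuclideanSpace ℝ (Fin 3)))) (fun δ => δ ^ (-Δ))
      n δ x =
      narrowFamily Δ n (fun i => δ • (WithLp.toLp 2 fun j => ((latticeApprox δ (x i) j : ℤ) : ℝ) :
        EuclideanSpace ℝ (Fin 3))) := by
  rw [rescaledCorrelator_apply, narrowFamily_isScaleCovariant Δ n δ hδ, ← Real.rpow_mul_natCast hδ.le]
  congr 2
  ring

/-- `x ↦ twoPt Δ (x i) (x j)` is continuous at configurations with `x i ≠ x j`. [folklore] -/
theorem continuousAt_twoPt (Δ : ℝ) {n : ℕ} {x : Fin n → EuclideanSpace ℝ (Fin 3)} {i j : Fin n}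
    (hij : x i ≠ x j) :
    ContinuousAt (fun y : Fin n → EuclideanSpace ℝ (Fin 3) => twoPt Δ (y i) (y j)) x := by
  unfold twoPt
  have hc : Continuous fun y : Fin n → EuclideanSpace ℝ (Fin 3) => ‖y i - y j‖ := by fun_prop
  exact hc.continuousAt.rpow_const (Or.inl (norm_ne_zero_iff.2 (sub_ne_zero.2 hij)))

/-- `sqSum` is continuous. [folklore] -/
theorem continuous_sqSum : Continuous sqSum := by
  unfold sqSum
  fun_prop

/-- The sharpened witness is continuous at every non-coincident configuration. [folklore] -/
theorem continuousAt_narrowFamily (Δ : ℝ) {n : ℕ} {x : Fin n → EuclideanSpace ℝ (Fin 3)}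
    (hx : x ∈ NonCoincident 3 n) : ContinuousAt (narrowFamily Δ n) x := by
  rw [mem_nonCoincident] at hx
  match n, x, hx with
  | 0, x, _ => exact continuousAt_const
  | 1, x, _ => exact continuousAt_const
  | 2, x, hx => exact continuousAt_twoPt Δ (hx.ne (by decide))
  | 3, x, _ => exact continuousAt_const
  | 4, x, hx =>
    have hw : ContinuousAt (wick Δ) x := by
      unfold wick
      exact ((continuousAt_twoPt Δ (hx.ne (by decide))).mul
        (continuousAt_twoPt Δ (hx.ne (by decide)))).add
        ((continuousAt_twoPt Δ (hx.ne (by decide))).mul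
        (continuousAt_twoPt Δ (hx.ne (by decide)))) |>.add
        ((continuousAt_twoPt Δ (hx.ne (by decide))).mul
        (continuousAt_twoPt Δ (hx.ne (by decide))))
    have hb : ContinuousAt (bump Δ) x := by
      unfold bump
      exact continuous_sqSum.continuousAt.rpow_const (Or.inl (sqSum_pos hx).ne')
    have hev : (fun y => wick Δ y - bump Δ y) =ᶠ[𝓝 x] narrowFamily Δ 4 := by
      have hopen := (isOpen_nonCoincident 3 4).mem_nhds ((mem_nonCoincident x).2 hx)
      filter_upwards [hopen] with y hy
      rw [narrowFamily_four_of_injective Δ ((mem_nonCoincident y).1 hy)]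
    exact (hw.sub hb).congr hev
  | (n + 5), x, _ => exact continuousAt_const

/-- **The sampled witness converges back pointwise**: renormalised by `δ^{-Δ}`, its rescaled
`n`-point functions tend to `narrowFamily Δ n x` at every non-coincident `x`. [folklore] -/
theorem latticeSample_narrowFamily_tendsto (Δ : ℝ) (n : ℕ) {x : Fin n → EuclideanSpace ℝ (Fin 3)}
    (hx : x ∈ NonCoincident 3 n) :
    Tendsto (fun δ => rescaledCorrelator (fun n k => narrowFamily Δ n (fun i =>
        (WithLp.toLp 2 fun j => ((k i j : ℤ) : ℝ) : EuclideanSpace ℝ (Fin 3)))) (fun δ => δ ^ (-Δ))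
      n δ x) (𝓝[>] 0) (𝓝 (narrowFamily Δ n x)) := by
  have h := (continuousAt_narrowFamily Δ hx).tendsto.comp (tendsto_mesh_smul_round_config x)
  refine h.congr' ?_
  have hpos : ∀ᶠ δ : ℝ in 𝓝[>] 0, 0 < δ := eventually_mem_nhdsWithin
  filter_upwards [hpos] with δ hδ
  rw [Function.comp_apply, rescaledCorrelator_latticeSample_narrowFamily Δ n hδ]

end ScaleNotMoebius

open ScaleNotMoebius Filter Topology in
/-- **No Möbius-covariant scaling limit of the sampled witness, under any renormalisation and any
dimension (existential form; proved).** For every `Δ > 0` the lattice sampling of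
`narrowFamily Δ` admits no `(ρ, Δ', S)` with `ρ > 0` on `(0,1]`, `Δ' > 0`,
`HasPointwiseScalingLimit _ ρ S`, `IsNondegenerateTwoPoint S` and `IsMoebiusCovariant Δ' S`:
by `tendsto_rescaledCorrelator_unique_upToScalar` and `latticeSample_narrowFamily_tendsto`,
`S = κⁿ · narrowFamily Δ` on non-coincident configurations; scale covariance at
`(0,e) ↦ (0,2e)` forces `Δ' = Δ`; inversion covariance at `(e, 2e, 3e, 4e)` then reads
`(24/65)^{2Δ} = (24/40)^{2Δ}` (the computation of `narrowFamily_not_isInversionCovariant`).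
[folklore] -/
theorem not_exists_moebiusLimit_latticeSample {Δ : ℝ} (hΔ : 0 < Δ) :
    ¬ ∃ (ρ : ℝ → ℝ) (Δ' : ℝ) (S : CorrFamily 3), (∀ δ ∈ Set.Ioc (0:ℝ) 1, 0 < ρ δ) ∧ 0 < Δ' ∧
      HasPointwiseScalingLimit (fun n k => narrowFamily Δ n (fun i =>
        (WithLp.toLp 2 fun j => ((k i j : ℤ) : ℝ) : EuclideanSpace ℝ (Fin 3)))) ρ S ∧
      IsNondegenerateTwoPoint S ∧ IsMoebiusCovariant Δ' S := by
  rintro ⟨ρ', Δ', S', hρ', -, hlim', hnd', hM'⟩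
  -- every limit is `κⁿ · narrowFamily Δ` on non-coincident configurations
  have hρ : ∀ δ ∈ Set.Ioc (0 : ℝ) 1, 0 < (fun δ : ℝ => δ ^ (-Δ)) δ := fun δ hδ =>
    Real.rpow_pos_of_pos hδ.1 _
  obtain ⟨κ, hκ, hS'⟩ := tendsto_rescaledCorrelator_unique_upToScalar hρ hρ'
    (fun n x hx => latticeSample_narrowFamily_tendsto Δ n hx)
    (fun n x hx => (hlim' n).tendsto_at hx) (narrowFamily_isNondegenerateTwoPoint Δ) hnd'
  -- the dimension is forced: `Δ' = Δ`
  have hΔeq : Δ' = Δ := by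
    have e1 := zero_axisUnit_mem_nonCoincident
    have e2 := zero_two_smul_axisUnit_mem_nonCoincident
    have hcfg : (fun i => (2 : ℝ) • (![0, axisUnit] : Fin 2 → EuclideanSpace ℝ (Fin 3)) i) =
        ![0, (2 : ℝ) • axisUnit] := by
      funext i; fin_cases i <;> simp
    have hsc := hM'.isScaleCovariant 2 2 two_pos ![0, axisUnit]
    rw [hcfg, hS' 2 _ e2, hS' 2 _ e1, narrowFamily_two, narrowFamily_two, twoPt, twoPt] at hsc
    simp only [Matrix.cons_val_zero, Matrix.cons_val_one, zero_sub, norm_neg, norm_smul,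
      Real.norm_eq_abs, norm_axisUnit, mul_one, Real.one_rpow, Nat.cast_ofNat] at hsc
    rw [abs_of_pos two_pos] at hsc
    have hk2 : (κ ^ 2 : ℝ) ≠ 0 := pow_ne_zero 2 hκ.ne'
    have h1 : (2 : ℝ) ^ (-(2 * Δ)) = (2 : ℝ) ^ (-2 * Δ') := by
      have h' : (2 : ℝ) ^ (-(2 * Δ)) * κ ^ 2 = (2 : ℝ) ^ (-2 * Δ') * κ ^ 2 := by
        linear_combination hsc
      exact mul_right_cancel₀ hk2 h'
    have h2 := congrArg Real.log h1
    rw [Real.log_rpow two_pos, Real.log_rpow two_pos] at h2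
    have hlog : Real.log 2 ≠ 0 := (Real.log_pos one_lt_two).ne'
    have h3 := mul_right_cancel₀ hlog h2
    linarith
  -- inversion covariance of `S'` at `(e, 2e, 3e, 4e)` transfers to `narrowFamily Δ`
  have hinj' : Function.Injective (fun i => inversion 0 1 (configInv i)) :=
    (inversion_injective (0 : EuclideanSpace ℝ (Fin 3)) one_ne_zero).comp configInv_injective
  have key' := hM'.isInversionCovariant 4 configInv configInv_ne_zero
  rw [hS' 4 _ ((mem_nonCoincident _).2 hinj'), hS' 4 _ ((mem_nonCoincident _).2 configInv_injective),
    hΔeq] at key'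
  have key : narrowFamily Δ 4 (fun i => inversion 0 1 (configInv i)) =
      (∏ i, ‖configInv i‖ ^ (2 * Δ)) * narrowFamily Δ 4 configInv := by
    have hk4 : κ ^ 4 ≠ 0 := pow_ne_zero 4 hκ.ne'
    have h' : κ ^ 4 * narrowFamily Δ 4 (fun i => inversion 0 1 (configInv i)) =
        κ ^ 4 * ((∏ i, ‖configInv i‖ ^ (2 * Δ)) * narrowFamily Δ 4 configInv) := by
      rw [key']; ring
    exact mul_left_cancel₀ hk4 h'
  rw [narrowFamily_four_of_injective Δ hinj', narrowFamily_four_of_injective Δ configInv_injective,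
    wick_inversion Δ configInv_ne_zero, mul_sub] at key
  have key2 : bump Δ (fun i => inversion 0 1 (configInv i)) =
      (∏ i, ‖configInv i‖ ^ (2 * Δ)) * bump Δ configInv := by linarith
  rw [bump, bump, sqSum_inversion_configInv, sqSum_configInv, prod_norm_configInv] at key2
  have e1 : (65 / 24 : ℝ) ^ (-(2 * Δ)) = (24 / 65 : ℝ) ^ (2 * Δ) := by
    rw [Real.rpow_neg (by norm_num), ← Real.inv_rpow (by norm_num), inv_div]
  have e2 : (24 : ℝ) ^ (2 * Δ) * (40 : ℝ) ^ (-(2 * Δ)) = (24 / 40 : ℝ) ^ (2 * Δ) := by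
    rw [Real.rpow_neg (by norm_num), ← div_eq_mul_inv, ← Real.div_rpow (by norm_num) (by norm_num)]
  have lt : (24 / 65 : ℝ) ^ (2 * Δ) < (24 / 40 : ℝ) ^ (2 * Δ) :=
    Real.rpow_lt_rpow (by norm_num) (by norm_num) (by positivity)
  rw [e1, e2] at key2
  exact lt.ne key2

open ScaleNotMoebius Filter Topology in
/-- **The sampled witness lies in the technique class and violates the upgrade**: for `Δ > 0` the
lattice family `G♮_Δ` (the sampling of `narrowFamily Δ` on `ℤ³`) has the exact isotropic two-point
power law (`latticeSample_narrowFamily_twoPointLaw`) and no non-degenerate Möbius-covariant pointwise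
scaling limit under any renormalisation and any dimension (`not_exists_moebiusLimit_latticeSample`),
so `TwoPointLawMoebiusUpgradeFor G♮_Δ` fails. [folklore] -/
theorem not_twoPointLawMoebiusUpgradeFor_latticeSample {Δ : ℝ} (hΔ : 0 < Δ) :
    ¬ TwoPointLawMoebiusUpgradeFor (fun n k => narrowFamily Δ n (fun i =>
        (WithLp.toLp 2 fun j => ((k i j : ℤ) : ℝ) : EuclideanSpace ℝ (Fin 3)))) := by
  intro h
  obtain ⟨Δ', c, hc, hP⟩ := latticeSample_narrowFamily_twoPointLaw Δ
  exact not_exists_moebiusLimit_latticeSample hΔ (h ⟨Δ', c, hc, hP⟩)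

/-- **The two-point-law Möbius upgrade is false** (the master statement of the technique class,
`∀ G, TwoPointLawMoebiusUpgradeFor G`, refuted): the sampling of `narrowFamily 1` has the exact
isotropic two-point power law and no non-degenerate Möbius-covariant scaling limit under any
renormalisation. Consequently a route item of the shape "two-point power law of `criticalCorr 3` ⇒
Möbius limit of `criticalCorr 3`" can only be proved from properties of `criticalCorr 3` beyond its
two-point function. (Displayed until the verdict clean-up of 2026-08-15 as `¬ TwoPointLawMoebiusUpgrade`,
definitionally the same statement; that closed def is deleted — REFUTED, retired from the named-fact
ledger — and this theorem is its refutation of record.) [folklore] -/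
theorem not_twoPointLawMoebiusUpgrade : ¬ ∀ G : LatticeCorrFamily 3, TwoPointLawMoebiusUpgradeFor G :=
  fun h => not_twoPointLawMoebiusUpgradeFor_latticeSample one_pos (h _)

end Literature.Barriers.CriticalPhenomena

end
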